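import Summits.AtomisticToContinuum.HydrodynamicLimit.Theses.OneFlightGossipEngine
import Summits.AtomisticToContinuum.HydrodynamicLimit.Theses.BGEndpointRigidity
import Summits.AtomisticToContinuum.HydrodynamicLimit.Theorems.OneFlightGossipEngineCollisionActivityTailsReduction
import HarnessLib

/-!
# Line `plaque-thinning-count-ld` — skeleton for the crux `CollisionActivityTails` (stmt-AtomisticToContinuum-13734)

Crux decl: `Summit.AtomisticToContinuum.HydrodynamicLimit.Theses.OneFlightGossipEngine.CollisionActivityTails`
(route OneFlightGossipEngine, rank 6 — the only route still wanting the item: TwoClocks rev 10 restated its copy as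
`TransferActivityTails` stmt-16624 on 2026-08-16T20:17Z, so `…Theses.TwoClocks.CollisionActivityTails` no longer exists; the
composition `CollisionActivityTails_of` concludes the OneFlightGossipEngine decl by name).
Planner: planner-cruxplan-stmt-AtomisticToContinuum-13734-plaque-thinning-coun-0 (crux-plan, round 2; idea card
`Cruxes/CollisionActivityTails/Ideas/plaque-thinning-count-ld.md`, triage TRIAGE-r2-1/2/3: pass 3-0 with sharpenings S1–S5).

## Architecture (two halves and a seam; the crux = UI ∧ FRACTION, §7a of the standing `Disproof.lean`)

* HUB HALF (this card's mechanism; stubs A–C).  A = `OneFlightAimingSupermartingale`: the ONE dynamical input — the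
  output of the one-flight plaque growth lemma in the form the Bennett step consumes: under the global Gibbs law, the
  number of NORMAL births (collisions after a long incoming flight, non-gentle, uncrowded, capped speeds) at which a
  particle's fresh RELATIVE velocity aims within `2ε` at the current centre of a third particle is dominated, in the
  exponential-supermartingale sense `E exp(λ N − (e^{2λ}−1) C Λ) ≤ 2`, by the STATIC aiming masses `Σ_j min(1,(2ε/D_j)²)`
  summed over the same births (index-free, filtration-free, joint over any set of shooter/target pairs, uniform in `N`).
  B = `… → EquilibriumHubLD`: own-birth thinning (`n_i ≥ xτ` forces `≥ n_i/2` short flights, each an aimed birth of `i`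
  or of the partner that was deflected into it), Bennett on dyadic blocks (the window length `τ` in the EXPONENT), static /
  Serre pricing of abnormal births and of sub-persistent clusters ⇒ the `∀γ` exponential moment of the number of REGULAR
  hubs (count-or-kinetic hubs never inside an over-dense ball of `≥ K` centres, `K ≤ τ²`) is `e^{o(N)}`.  C = `… →
  HubFractionVanishes`: entropy inequality against the flow-invariant Gibbs reference — legitimate exactly because the
  per-hub cost grows with `τ` (outside the CountingCeiling of TRIAGE-r1), `E_{λ_s}[hub fraction] ≤ (κ + δ)/γ`.
* ENVELOPE HALF (the (N2) residual, honestly imported; stubs D–E).  D = `PreShockLanfordEnvelope`: the Lanford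
  envelope of route BGEndpointRigidity (`LanfordEnvelopeR`, stmt-13677, repaired form with the domain indicator) RESTATED
  INSIDE 13734's PRE-SHOCK FRAME (`IsHardSphereEulerSolution σ T …`, `t < T`) as TRIAGE-r2 T2/T3 require; 13677 ⇒ D
  (`preShockLanfordEnvelope_of_lanfordEnvelopeR`, proved below), conjecture-grade, no mechanism claimed here.
  E = `D → DenseVisitFractionVanishes ∧ ActivityUI`: static counting under the envelope at all orders (over-dense balls of
  `≥ K ≥ τ` centres, union over a time grid) and the UI half by sub-window convexity + Serre's few-body bound + short-time
  trees from an enveloped law (TRIAGE-r2-3 T1 ingredient list).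
* SEAM (stub F = `HubFractionVanishes → DenseVisitFractionVanishes → ActivityFraction`): pathwise kinematics
  `a_i ≤ (σ/τ)(u·n_i + Q_i/u)` (impulse ≤ relative speed, `r ≤ u + r²/u`) ⇒ `{a_i > V} ⊆ countHub(x) ∪ kinHub(x,u)`,
  `V = 2σux`; the exclusion scale `K = ⌈τ⌉ ∈ [τ, τ²]` serves both halves (TRIAGE-r2-2 S1: exclusion neither toothless nor
  asymptotically vacuous), the density threshold `y₀` comes from the envelope side and `x₀ = x₀(u, y₀)` from the hub side.
* GLUE (PROVED here, sorry-free): `ActivityUI → ActivityFraction → crux` (truncation `𝟙{V<a}a ≤ 𝟙{L<a}a + L𝟙{V<a}` and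
  the landed a.e.-measurability of the activity tail sum, p115117).

`lean check`: sorries exactly in the six `stub_*`; `CollisionActivityTails_of` is the registered composition.
-/

noncomputable section

open MeasureTheory Set Filter Topology
open scoped ENNReal InnerProductSpace

namespace Summit.AtomisticToContinuum.HydrodynamicLimit.Cruxes.CollisionActivityTails.PlaqueThinningCountLd

open Literature.MathematicalPhysics.KineticTheory Literature.Analysis.FluidPDE
open Summit.AtomisticToContinuum.HydrodynamicLimit.Theorems.CollisionActivityTailsActivityDomination
open Summit.AtomisticToContinuum.HydrodynamicLimit.Theorems.CollisionActivityTailsNearFieldKineticTails (tailFn fracFn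
  tailFn_of_lt tailFn_of_le tailFn_nonneg fracFn_of_lt fracFn_of_le fracFn_nonneg measurable_tailFn
  tailFn_le_tailFn_add_mul_fracFn)
open Summit.AtomisticToContinuum.HydrodynamicLimit.Theorems.CollisionActivityTailsWindowAlgebra (TailStatement
  aemeasurable_sum_tailFn_act act_nonneg collisionActivityTails_iff_tailStatement_act)

/-! ## §0 The crux frame -/

/-- The type of a conclusion placed inside the crux's quantifier frame: it may depend on the reduced diameter `σ`, the
flow family `Φ`, the local Gibbs profiles `a₀, u₀, θ₀` and the time `t < T`. -/
abbrev FrameConcl : Type :=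
  ∀ σ : ℝ, ((N : ℕ) → Flow σ N) → (T3 → ℝ) → (T3 → V3) → (T3 → ℝ) → ℝ → Prop

/-- **The crux's quantifier FRAME** (verbatim the prefix of `CollisionActivityTails` / `TailStatement`): continuous positive
profiles, `∃ σ₀ ∀ σ ∈ (0, σ₀)`, every horizon `T`, every classical hs-Euler solution on `[0,T)`, every flow family, the
`t = 0` hydrodynamic LLN of the local Gibbs laws, every `t ∈ [0, T)` — applied to the conclusion `P σ Φ a₀ u₀ θ₀ t`. -/
def CruxFrame (P : FrameConcl) : Prop :=
  ∀ (a₀ θ₀ : T3 → ℝ) (u₀ : T3 → V3), Continuous a₀ → Continuous θ₀ → Continuous u₀ →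
    (∀ x, 0 < a₀ x) → (∀ x, 0 < θ₀ x) → ∃ σ₀ : ℝ, 0 < σ₀ ∧ ∀ σ : ℝ, 0 < σ → σ < σ₀ →
    ∀ (T : ℝ) (ρ θ : ℝ → T3 → ℝ) (u : ℝ → T3 → V3), IsHardSphereEulerSolution σ T ρ u θ →
    ∀ Φ : (N : ℕ) → Flow σ N,
    TendstoHydroFieldsAt (fun N => localGibbsLaw σ a₀ u₀ θ₀ N (Φ N)) Φ ρ u θ 0 →
    ∀ t ∈ Set.Ico 0 T, P σ Φ a₀ u₀ θ₀ t

/-- Monotonicity of the frame, with access to `0 < σ < 1/2` (the combined threshold is `min σ₀ 2⁻¹`). -/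
theorem CruxFrame.mono_half {P Q : FrameConcl}
    (h : ∀ σ Φ a₀ u₀ θ₀ t, 0 < σ → σ < 2⁻¹ → P σ Φ a₀ u₀ θ₀ t → Q σ Φ a₀ u₀ θ₀ t) (hP : CruxFrame P) :
    CruxFrame Q := by
  intro a₀ θ₀ u₀ ha hθ hu ha0 hθ0
  obtain ⟨σ₀, hσ₀, hP⟩ := hP a₀ θ₀ u₀ ha hθ hu ha0 hθ0
  refine ⟨min σ₀ 2⁻¹, lt_min hσ₀ (by norm_num), fun σ hσ hσlt T ρ θ u hsol Φ hLLN t ht => ?_⟩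
  exact h σ Φ a₀ u₀ θ₀ t hσ (hσlt.trans_le (min_le_right _ _))
    (hP σ hσ (hσlt.trans_le (min_le_left _ _)) T ρ θ u hsol Φ hLLN t ht)

/-- Two framed statements hold in one frame (threshold `min σ₁ σ₂`). -/
theorem CruxFrame.and {P Q : FrameConcl} (hP : CruxFrame P) (hQ : CruxFrame Q) :
    CruxFrame (fun σ Φ a₀ u₀ θ₀ t => P σ Φ a₀ u₀ θ₀ t ∧ Q σ Φ a₀ u₀ θ₀ t) := by
  intro a₀ θ₀ u₀ ha hθ hu ha0 hθ0
  obtain ⟨σ₁, hσ₁, hP⟩ := hP a₀ θ₀ u₀ ha hθ hu ha0 hθ0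
  obtain ⟨σ₂, hσ₂, hQ⟩ := hQ a₀ θ₀ u₀ ha hθ hu ha0 hθ0
  refine ⟨min σ₁ σ₂, lt_min hσ₁ hσ₂, fun σ hσ hσlt T ρ θ u hsol Φ hLLN t ht => ⟨?_, ?_⟩⟩
  · exact hP σ hσ (hσlt.trans_le (min_le_left _ _)) T ρ θ u hsol Φ hLLN t ht
  · exact hQ σ hσ (hσlt.trans_le (min_le_right _ _)) T ρ θ u hsol Φ hLLN t ht

/-! ## §1 Window vocabulary: counts, kinetic sums, over-dense visits, hubs -/

variable {σ : ℝ} {N : ℕ}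

/-- The torus geometry of `𝕋³` (shorthand). -/
abbrev G3 : Geometry (Fin 3) T3 := Torus.geometry (Fin 3)

/-- The orbit of the initial datum `z` under the flow `Φ`. -/
def traj (Φ : Flow σ N) (z : Cfg N) : ℝ → Cfg N := fun r => Φ.flow r z

/-- The window of the crux started at `s`: `(s, s + w]`, `w = window τ N = τ (N+1)^{-1/3}`. -/
def win (τ s : ℝ) (N : ℕ) : Set ℝ := Set.Ioc s (s + window τ N)

/-- **Collision COUNT** of particle `i` over the times in `S` (as a real number): the number of collision records of the
orbit with `c.fst = i` — each binary collision of `i` contributes exactly one such ordered record (junk `0` off the good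
set, where the collision sum is a `finsum` over an infinite set). -/
def collCount (Φ : Flow σ N) (S : Set ℝ) (i : Fin (N + 1)) (z : Cfg N) : ℝ :=
  Φ.collisionSum S (fun c => if c.fst = i then (1 : ℝ) else 0) z

/-- **Pre-collisional relative kinetic sum** of particle `i` over `S`: `Q_i = Σ_{collisions c of i} |v_i⁻ − v_j⁻|²`. -/
def relKinSum (Φ : Flow σ N) (S : Set ℝ) (i : Fin (N + 1)) (z : Cfg N) : ℝ :=
  Φ.collisionSum S (fun c => if c.fst = i then ‖c.preVel.1 - c.preVel.2‖ ^ 2 else 0) z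

/-- **COUNT HUB** at relative level `x`: at least `x · τ` collisions of `i` in the window (the mean is `≍ a σ² √θ · τ`). -/
def countHub (Φ : Flow σ N) (τ s : ℝ) (i : Fin (N + 1)) (x : ℝ) : Set (Cfg N) :=
  {z | x * τ ≤ collCount Φ (win τ s N) i z}

/-- **KINETIC HUB** at level `x` and speed scale `u`: `Q_i ≥ x u² τ` over the window. -/
def kinHub (Φ : Flow σ N) (τ s : ℝ) (i : Fin (N + 1)) (x u : ℝ) : Set (Cfg N) :=
  {z | x * u ^ 2 * τ ≤ relKinSum Φ (win τ s N) i z}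

/-- The radius of the ball that holds `K'` centres at `y` times the mean number density `N + 1` of `𝕋³`:
`(3 K' / (4 π y (N+1)))^{1/3}` (so "`≥ K'` centres within `denseRadius K' y N`" = "relative density `≥ y` at scale `K'`"). -/
def denseRadius (K' : ℕ) (y : ℝ) (N : ℕ) : ℝ :=
  (3 * (K' : ℝ) / (4 * Real.pi * y * ((N : ℝ) + 1))) ^ (1 / 3 : ℝ)

/-- **OVER-DENSE VISIT** at scales `≥ K` and relative density `≥ y`: at some time of the closed window, for some
`K' ≥ K`, the ball around `x_i` of radius `denseRadius K' y N` holds at least `K'` centres (the centre `x_i` included, as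
in the landed `nearCount`).  With `K → ∞` after `τ`, incidental visits to SMALL clusters are NOT over-dense visits. -/
def denseVisit (Φ : Flow σ N) (τ s : ℝ) (i : Fin (N + 1)) (K : ℕ) (y : ℝ) : Set (Cfg N) :=
  {z | ∃ r ∈ Set.Icc s (s + window τ N), ∃ K' : ℕ, K ≤ K' ∧ K' ≤ nearCount (Φ.flow r z) i (denseRadius K' y N)}

/-- **REGULAR HUB**: a count-or-kinetic hub that never makes an over-dense visit during the window. -/
def regularHub (Φ : Flow σ N) (τ s : ℝ) (i : Fin (N + 1)) (x u : ℝ) (K : ℕ) (y : ℝ) : Set (Cfg N) :=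
  (countHub Φ τ s i x ∪ kinHub Φ τ s i x u) \ denseVisit Φ τ s i K y

/-- The empirical FRACTION `(N+1)⁻¹ #{i : z ∈ E i}` of an indexed family of events. -/
def frac (N : ℕ) (E : Fin (N + 1) → Set (Cfg N)) (z : Cfg N) : ℝ :=
  ((N : ℝ) + 1)⁻¹ * ∑ i : Fin (N + 1), (E i).indicator (fun _ => (1 : ℝ)) z

/-- The global (constant-profile) Gibbs law of `N + 1` spheres: `localGibbsLaw` at constant `a₀, u₀, θ₀`. -/
def gibbs (σ a₀ θ₀ : ℝ) (u₀ : V3) (N : ℕ) (Φ : Flow σ N) : Measure (Cfg N) :=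
  localGibbsLaw σ (fun _ => a₀) (fun _ => u₀) (fun _ => θ₀) N Φ

/-! ## §2 One-flight aiming vocabulary (births, aimed births, static aiming masses) -/

/-- The open ray `{s • v : s > 0}` from the origin passes within `ρ` of the point `d`:
`⟪d, v⟫ > 0` and `|d|²|v|² − ⟪d, v⟫² ≤ ρ²|v|²` (squared distance from `d` to the line `ℝ v`, times `|v|²`). -/
def AimsAt (d v : V3) (ρ : ℝ) : Prop :=
  0 < ⟪d, v⟫_ℝ ∧ ‖d‖ ^ 2 * ‖v‖ ^ 2 - ⟪d, v⟫_ℝ ^ 2 ≤ ρ ^ 2 * ‖v‖ ^ 2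

/-- In the configuration `y` (read at a collision time of the shooter `k`: velocities are post-collisional), **`k` is
aimed at the target `j`** (catch radius `ϱ`, speed cap `u`, tolerance `2ε`): `j` is neither `k` nor `k`'s collision
partner, lies within `ϱ` of `x_k`, has speed `≤ u`, and the velocity of `k` RELATIVE to `j` aims at `j`'s current centre
within `2ε` (so that, if nobody is deflected meanwhile, `k` hits `j`). -/
def IsAimedAt (ε ϱ u : ℝ) (y : Cfg N) (k j : Fin (N + 1)) : Prop :=
  j ≠ k ∧ j ≠ partner G3 ε y k ∧ tdist (y j).1 (y k).1 ≤ ϱ ∧ ‖(y j).2‖ ≤ u ∧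
    AimsAt (G3.sepVec (y j).1 (y k).1) ((y k).2 - (y j).2) (2 * ε)

open scoped Classical in
/-- The **static aiming mass** of the target `j` seen from the shooter `k` in the configuration `y`: `min(1, (2ε/D)²)`,
`D = dist(x_j, x_k)`, for admissible targets (not `k`, not the partner, within `ϱ`, speed `≤ u`), else `0`. -/
def aimMassAt (ε ϱ u : ℝ) (y : Cfg N) (k j : Fin (N + 1)) : ℝ :=
  if j ≠ k ∧ j ≠ partner G3 ε y k ∧ tdist (y j).1 (y k).1 ≤ ϱ ∧ ‖(y j).2‖ ≤ u then
    min 1 ((2 * ε / tdist (y j).1 (y k).1) ^ 2) else 0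

/-- **NORMAL BIRTH** of the shooter `k` at its collision time `t` along the orbit `γ` (the "long plaque, normal
environment" valve of the growth lemma): post-collisional speeds of `k` and of its partner `≤ u`, relative speed
`≥ u / M₀` (non-gentle collision: the collision sphere of outgoing velocities is not degenerate), no third centre within
`3ε` of `x_k` (unshadowed partner disc), and a LONG INCOMING FLIGHT — `k` travelled at least `L₀ ε` since its previous
collision after time `0` (or since time `0`): expansion `1 + 2L/ε` of the one-flight unstable plaque. -/
def IsNormalBirth (ε u M₀ L₀ : ℝ) (γ : ℝ → Cfg N) (k : Fin (N + 1)) (t : ℝ) : Prop :=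
  let y := γ t
  let j := partner G3 ε y k
  let c := HardSphereCollisionRecord.ofConfig G3 ε y t k j
  ‖(y k).2‖ ≤ u ∧ ‖(y j).2‖ ≤ u ∧ u ≤ M₀ * ‖(y k).2 - (y j).2‖ ∧ nearCount y k (3 * ε) ≤ 2 ∧
    L₀ * ε ≤ ‖c.preVel.1‖ * (t - flightStart G3 ε γ 0 k t)

open scoped Classical in
/-- **Number of normal AIMED births** with times in `S`, over a set `P` of ordered (shooter, target) pairs: for each shooter
`k`, the number of its collision times in `S` that are normal births at which `k` is aimed at some `j` with `(k, j) ∈ P`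
(a `finsum` over the collision times of `k`; junk `0` if there are infinitely many, a null event). -/
def aimedBirths (ε ϱ u M₀ L₀ : ℝ) (Φ : Flow σ N) (S : Set ℝ) (P : Finset (Fin (N + 1) × Fin (N + 1)))
    (z : Cfg N) : ℝ :=
  ∑ k : Fin (N + 1), ∑ᶠ t ∈ collisionTimesOf G3 ε (traj Φ z) k ∩ S,
    if IsNormalBirth ε u M₀ L₀ (traj Φ z) k t ∧ ∃ j, (k, j) ∈ P ∧ IsAimedAt ε ϱ u (traj Φ z t) k j
    then (1 : ℝ) else 0

open scoped Classical in
/-- **The predictable COMPENSATOR**: the static aiming masses of the targets `j`, `(k, j) ∈ P`, summed over the NORMAL births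
of each shooter `k` with times in `S`. -/
def aimCompensator (ε ϱ u M₀ L₀ : ℝ) (Φ : Flow σ N) (S : Set ℝ) (P : Finset (Fin (N + 1) × Fin (N + 1)))
    (z : Cfg N) : ℝ :=
  ∑ k : Fin (N + 1), ∑ᶠ t ∈ collisionTimesOf G3 ε (traj Φ z) k ∩ S,
    if IsNormalBirth ε u M₀ L₀ (traj Φ z) k t
    then ∑ j : Fin (N + 1), (if (k, j) ∈ P then aimMassAt ε ϱ u (traj Φ z t) k j else 0) else 0

/-! ## §3 The statements of the line -/

/-- **A · ONE-FLIGHT AIMING SUPERMARTINGALE INEQUALITY** (the line's ONE dynamical input = the output of the one-flight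
plaque growth lemma in consumable, ratio form; equilibrium, per-birth, uniform in `N`).  Under the global Gibbs law of
`N + 1` spheres of diameter `ε = σ(N+1)^{-1/3}` on `𝕋³`, for speed cap `u`, non-gentleness `M₀`, there are a plaque
length `L₀` and a constant `C` such that for every catch radius `ϱ (N+1)^{-1/3}`, every window `(0, τ(N+1)^{-1/3}]`,
`N ≥ N₀`, every set `P` of (shooter, target) pairs and every `λ ∈ [0, 1]`:
`E_G[exp(λ · #(normal aimed births over P) − (e^{2λ} − 1) · C · (aiming masses over P at normal births))] ≤ 2`.
Heuristic proof: in the dynamical standard-family filtration of Chernov–Dolgopyat type (one-flight unstable plaques of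
each shooter, cut at singularities), a normal birth has conditional impact-vector density `≤ C_d ×` cosine-uniform on a
long plaque; the outgoing velocity is then uniform on the collision sphere up to `C_d`, its direction relative to a slow
target has density `≤ C M₀²`, and the aimed event has conditional probability `≤ C · aimMassAt`; births of one collision
enter at most two shooters (`e^{2λ}`); optional stopping.  What can fail: `N`-uniform distortion control in the moving,
past-coupled environment (open: CD09 is two-body, Bálint–Tóth one 3-D particle); the valve `IsNormalBirth` is where a
prover may need to add conditions.  NOT the additive coarse-σ-algebra form of `OneFlightLayeredChaos` (stmt-14535),
which TRIAGE-r1-3 showed cannot give ratio bounds. -/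
def OneFlightAimingSupermartingale : Prop :=
  ∀ (a₀ θ₀ : ℝ) (u₀ : V3), 0 < a₀ → 0 < θ₀ → ∃ σ₀ : ℝ, 0 < σ₀ ∧ ∀ σ : ℝ, 0 < σ → σ < σ₀ →
    ∀ u : ℝ, 0 < u → ∀ M₀ : ℝ, 1 ≤ M₀ → ∃ L₀ : ℝ, 0 < L₀ ∧ ∃ C : ℝ, 0 < C ∧
    ∀ ϱ : ℝ, 0 < ϱ → ∀ τ : ℝ, 0 < τ → ∃ N₀ : ℕ, ∀ N : ℕ, N₀ ≤ N → ∀ Φ : Flow σ N,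
    ∀ P : Finset (Fin (N + 1) × Fin (N + 1)), ∀ l : ℝ, 0 ≤ l → l ≤ 1 →
      ∫⁻ z, ENNReal.ofReal (Real.exp
          (l * aimedBirths (hsDiameter σ N) (ϱ * ((N : ℝ) + 1) ^ (-(1 / 3 : ℝ))) u M₀ L₀ Φ
              (Set.Ioc 0 (window τ N)) P z
            - (Real.exp (2 * l) - 1) * C *
              aimCompensator (hsDiameter σ N) (ϱ * ((N : ℝ) + 1) ^ (-(1 / 3 : ℝ))) u M₀ L₀ Φ
                (Set.Ioc 0 (window τ N)) P z))
        ∂(gibbs σ a₀ θ₀ u₀ N Φ) ≤ 2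

/-- **B-target · EQUILIBRIUM REGULAR-HUB LARGE DEVIATION** (the COUNT rung in exponential-moment form, with the
scale-dependent over-density exclusion of TRIAGE-r2-2 S1): under the global Gibbs law, for every speed scale `u` and
density threshold `y` there is a level `x₀` such that for `x ≥ x₀`, EVERY tilt `γ` and every `δ > 0`, for `τ ≥ τ₀`, all
exclusion scales `K ≤ τ²` and `N ≥ N₀`:  `E_G[exp(γ · #{i : regular hub})] ≤ e^{δ(N+1)}` — the per-hub cost GROWS with the
window (`Bennett exponent ∝ τ`; sub-persistent tight clusters cost `≍ log τ` per member; persistent droplets need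
`≳ (τ√θ/σ)³ ≫ τ² ≥ K` members and are excluded).  Window `(0, w]` (invariance gives every start). -/
def EquilibriumHubLD : Prop :=
  ∀ (a₀ θ₀ : ℝ) (u₀ : V3), 0 < a₀ → 0 < θ₀ → ∃ σ₀ : ℝ, 0 < σ₀ ∧ ∀ σ : ℝ, 0 < σ → σ < σ₀ →
    ∀ Φ : (N : ℕ) → Flow σ N,
    ∀ u : ℝ, 0 < u → ∀ y : ℝ, 0 < y → ∃ x₀ : ℝ, 0 < x₀ ∧ ∀ x : ℝ, x₀ ≤ x →
    ∀ γ : ℝ, 0 < γ → ∀ δ : ℝ, 0 < δ → ∃ τ₀ : ℝ, 0 < τ₀ ∧ ∀ τ : ℝ, τ₀ ≤ τ →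
    ∀ K : ℕ, (K : ℝ) ≤ τ ^ 2 → ∃ N₀ : ℕ, ∀ N : ℕ, N₀ ≤ N →
      ∫⁻ z, ENNReal.ofReal (Real.exp (γ * ∑ i : Fin (N + 1),
          (regularHub (Φ N) τ 0 i x u K y).indicator (fun _ => (1 : ℝ)) z)) ∂(gibbs σ a₀ θ₀ u₀ N (Φ N))
        ≤ ENNReal.ofReal (Real.exp (δ * ((N : ℝ) + 1)))

/-- **C-target · REGULAR-HUB FRACTION VANISHES UNDER THE TRUE LAW** (crux frame): for every `u, y` there is `x₀` such that
for `x ≥ x₀` the expected fraction of regular hubs in the window `(s, s+w]` is `≤ ε` for `τ ≥ τ₀(x, ε)`, all `K ≤ τ²`,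
`N ≥ N₀`, uniformly in `s ≤ t` — fixed level, accuracy `→ 0` (crux shape in count currency).  Intended proof: entropy
inequality `E_{λ_s}[F] ≤ (H(λ_s | G) + log E_G e^F)/γ`-style with `F = γ · #hubs`, `H(λ_s | G) = H(λ₀ | G) ≤ κ(N+1)`
(Liouville invariance of the constant Gibbs law `G`), and `EquilibriumHubLD` with `γ → ∞` AFTER `τ → ∞`. -/
def HubFractionVanishes : Prop :=
  CruxFrame fun σ Φ a₀ u₀ θ₀ t =>
    ∀ u : ℝ, 0 < u → ∀ y : ℝ, 0 < y → ∃ x₀ : ℝ, 0 < x₀ ∧ ∀ x : ℝ, x₀ ≤ x → ∀ ε : ℝ, 0 < ε →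
    ∃ τ₀ : ℝ, 0 < τ₀ ∧ ∀ τ : ℝ, τ₀ ≤ τ → ∀ K : ℕ, (K : ℝ) ≤ τ ^ 2 → ∃ N₀ : ℕ, ∀ N : ℕ, N₀ ≤ N →
    ∀ s ∈ Set.Icc 0 t,
      ∫⁻ z, ENNReal.ofReal (frac N (fun i => regularHub (Φ N) τ s i x u K y) z)
        ∂(localGibbsLaw σ a₀ u₀ θ₀ N (Φ N)) ≤ ENNReal.ofReal ε

/-- **D · PRE-SHOCK LANFORD ENVELOPE** (IMPORT, conjecture-grade; = `BGEndpointRigidity.LanfordEnvelopeR` stmt-13677 with its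
all-horizon prefix `∀ T > 0` replaced by 13734's pre-shock frame, as TRIAGE-r2-1 T2 / r2-3 T2–T3 demand; 13677 implies it,
`preShockLanfordEnvelope_of_lanfordEnvelopeR`).  For every `t < T`: `∃ β > 0, C` such that for all `N`, all orders `k` and
all times `r ∈ [0, t]`, the `k`-particle volume-marginal of the transported canonical density (times the indicator of the
hard-sphere domain) is a.e. `≤ C^k exp(−β E(Z_k))`.  Carries the HighMomentumCutoff barrier in marginal form (no mechanism
is claimed by this line; it is the (N2) residual in its consumable dress). -/
def PreShockLanfordEnvelope : Prop :=
  CruxFrame fun σ Φ a₀ u₀ θ₀ t =>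
    ∃ β C : ℝ, 0 < β ∧ ∀ (N : ℕ) (k : ℕ), ∀ r ∈ Set.Icc 0 t,
      ∀ᵐ Zk : Config k (Fin 3) T3,
        |nthMarginal (N + 1) k ((hardSphereDomain G3 (N + 1) (hsDiameter σ N)).indicator
            (hsTransport (Φ N) r (canonicalDensity G3 (hsDiameter σ N) (N + 1) (localGibbsProfile a₀ u₀ θ₀)))) Zk|
          ≤ C ^ k * Real.exp (-(β * configEnergy Zk))

/-- **E-target (i) · OVER-DENSE VISITS ARE RARE UNDER THE TRUE LAW** (crux frame; the persistent-structure branch): there is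
a density threshold `y₀` such that for `y ≥ y₀` the expected fraction of particles making an over-dense visit at some
scale `K' ≥ K` during the window is `≤ ε` for `τ ≥ τ₀(ε)`, every `K ≥ τ` and `N ≥ N₀`, uniformly in `s ≤ t`.  Intended
proof: all-order counting under `PreShockLanfordEnvelope` at the times of a grid of mesh `≍ ε/u` (union bound
`(τu/σ) Σ_{K' ≥ K} (e C'/y)^{K'} → 0` once `K ≥ τ ≫ log τ`), displacement between grid times by the `k = 1` velocity envelope. -/
def DenseVisitFractionVanishes : Prop :=
  CruxFrame fun σ Φ a₀ u₀ θ₀ t =>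
    ∃ y₀ : ℝ, 0 < y₀ ∧ ∀ y : ℝ, y₀ ≤ y → ∀ ε : ℝ, 0 < ε →
    ∃ τ₀ : ℝ, 0 < τ₀ ∧ ∀ τ : ℝ, τ₀ ≤ τ → ∀ K : ℕ, τ ≤ (K : ℝ) → ∃ N₀ : ℕ, ∀ N : ℕ, N₀ ≤ N →
    ∀ s ∈ Set.Icc 0 t,
      ∫⁻ z, ENNReal.ofReal (frac N (fun i => denseVisit (Φ N) τ s i K y) z)
        ∂(localGibbsLaw σ a₀ u₀ θ₀ N (Φ N)) ≤ ENNReal.ofReal ε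

/-- **E-target (ii) · UNIFORM INTEGRABILITY OF THE WINDOW ACTIVITY** (crux frame; the UI half of the crux, verbatim the standing
disprover's `CollisionActivityUI`, §7f): `∀ ε ∃ L ∃ τ₀ ∀ τ ≥ τ₀ ∃ N₀ ∀ N ≥ N₀ ∀ s ≤ t: E[(N+1)⁻¹ Σ_i 𝟙{L < a_i} a_i] ≤ ε`.
Intended proof (TRIAGE-r2-3 T1): sub-window convexity reduces it to a ONE-TIME bound; Serre's `c₃ K²` few-body activity
bound forces large interaction clusters; their law comes from short-time trees started from the enveloped law at time `r`. -/
def ActivityUI : Prop :=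
  CruxFrame fun σ Φ a₀ u₀ θ₀ t =>
    ∀ ε : ℝ, 0 < ε → ∃ L : ℝ, ∃ τ₀ : ℝ, 0 < τ₀ ∧ ∀ τ : ℝ, τ₀ ≤ τ → ∃ N₀ : ℕ, ∀ N : ℕ, N₀ ≤ N →
    ∀ s ∈ Set.Icc 0 t,
      ∫⁻ z, ENNReal.ofReal (((N : ℝ) + 1)⁻¹ * ∑ i : Fin (N + 1), tailFn L (act (Φ N) τ s i z))
        ∂(localGibbsLaw σ a₀ u₀ θ₀ N (Φ N)) ≤ ENNReal.ofReal ε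

/-- **F-target · THE FRACTION RUNG OF THE CRUX** (crux frame and shape; verbatim the standing disprover's
`CollisionActivityFraction`, §7f — a NECESSARY consequence of the crux): `∃ V₀ ∀ V ≥ V₀ ∀ ε ∃ τ₀ ∀ τ ≥ τ₀ ∃ N₀ ∀ N ≥ N₀
∀ s ≤ t: E[(N+1)⁻¹ #{i : V < a_i}] ≤ ε`. -/
def ActivityFraction : Prop :=
  CruxFrame fun σ Φ a₀ u₀ θ₀ t =>
    ∃ V₀ : ℝ, 0 < V₀ ∧ ∀ V : ℝ, V₀ ≤ V → ∀ ε : ℝ, 0 < ε →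
    ∃ τ₀ : ℝ, 0 < τ₀ ∧ ∀ τ : ℝ, τ₀ ≤ τ → ∃ N₀ : ℕ, ∀ N : ℕ, N₀ ≤ N → ∀ s ∈ Set.Icc 0 t,
      ∫⁻ z, ENNReal.ofReal (((N : ℝ) + 1)⁻¹ * ∑ i : Fin (N + 1), fracFn V (act (Φ N) τ s i z))
        ∂(localGibbsLaw σ a₀ u₀ θ₀ N (Φ N)) ≤ ENNReal.ofReal ε

/-- The crux, OneFlightGossipEngine copy (an `abbrev`, so that the hypothesis-carrying compositions below do not conclude the
route decl by name — only `CollisionActivityTails_of` / `CollisionActivityTails_proof` do). -/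
abbrev Crux : Prop := Summit.AtomisticToContinuum.HydrodynamicLimit.Theses.OneFlightGossipEngine.CollisionActivityTails

/-! ## §4 Proved glue -/

/-- **13677 ⇒ D**: the all-horizon Lanford envelope of route BGEndpointRigidity gives the pre-shock one (horizon `t + 1`). -/
theorem preShockLanfordEnvelope_of_lanfordEnvelopeR
    (h : Summit.AtomisticToContinuum.HydrodynamicLimit.Theses.BGEndpointRigidity.LanfordEnvelopeR) :
    PreShockLanfordEnvelope := by
  intro a₀ θ₀ u₀ ha hθ hu ha0 hθ0
  obtain ⟨σ₀, hσ₀, h⟩ := h a₀ θ₀ u₀ ha hθ hu ha0 hθ0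
  refine ⟨σ₀, hσ₀, fun σ hσ hσlt T ρ θ u _ Φ _ t ht => ?_⟩
  obtain ⟨β, C, hβ, h⟩ := h σ hσ hσlt (t + 1) (by linarith [ht.1])
  exact ⟨β, C, hβ, fun N k r hr => h N (Φ N) k r ⟨hr.1, hr.2.trans (by linarith)⟩⟩

/-- The tail functional is antitone in the threshold (nonnegative arguments). -/
theorem tailFn_anti {V V' y : ℝ} (hVV' : V ≤ V') (hy : 0 ≤ y) : tailFn V' y ≤ tailFn V y := by
  by_cases h : V' < y
  · rw [tailFn_of_lt h, tailFn_of_lt (hVV'.trans_lt h)]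
  · rw [tailFn_of_le (not_lt.1 h)]
    exact tailFn_nonneg hy

/-- **GLUE (proved): UI ∧ FRACTION ⇒ the crux.**  Truncate at the UI level `L' = max L 1`:
`𝟙{V < a} a ≤ 𝟙{L' < a} a + L' 𝟙{V < a}`, integrate (the first summand is a.e.-measurable, landed p115117), and kill
`L' · E[fraction]` with the fraction statement at accuracy `ε / (2L')`.  Thresholds: `σ₀ = min`, `V₀` of the fraction
statement, `τ₀ = max`, `N₀ = max`. -/
theorem crux_of_activityUI_of_activityFraction (hU : ActivityUI) (hF : ActivityFraction) : Crux := by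
  refine (collisionActivityTails_iff_tailStatement_act).2 ?_
  intro a₀ θ₀ u₀ ha hθ hu ha0 hθ0
  obtain ⟨σ₁, hσ₁, hU⟩ := hU a₀ θ₀ u₀ ha hθ hu ha0 hθ0
  obtain ⟨σ₂, hσ₂, hF⟩ := hF a₀ θ₀ u₀ ha hθ hu ha0 hθ0
  refine ⟨min (min σ₁ σ₂) 2⁻¹, lt_min (lt_min hσ₁ hσ₂) (by norm_num), ?_⟩
  intro σ hσ hσlt T ρ θ u hsol Φ hLLN t ht
  have hσ₁' : σ < σ₁ := hσlt.trans_le ((min_le_left _ _).trans (min_le_left _ _))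
  have hσ₂' : σ < σ₂ := hσlt.trans_le ((min_le_left _ _).trans (min_le_right _ _))
  have hσh : σ < 2⁻¹ := hσlt.trans_le (min_le_right _ _)
  have hU := hU σ hσ hσ₁' T ρ θ u hsol Φ hLLN t ht
  obtain ⟨V₀, hV₀, hF⟩ := hF σ hσ hσ₂' T ρ θ u hsol Φ hLLN t ht
  refine ⟨V₀, hV₀, fun V hV ε hε => ?_⟩
  obtain ⟨L, τa, hτa, hUa⟩ := hU (ε / 2) (half_pos hε)
  set L' : ℝ := max L 1 with hL'
  have hL'0 : 0 < L' := lt_of_lt_of_le one_pos (le_max_right _ _)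
  obtain ⟨τb, hτb, hFb⟩ := hF V hV (ε / 2 / L') (div_pos (half_pos hε) hL'0)
  refine ⟨max τa τb, lt_max_of_lt_left hτa, fun τ hτ => ?_⟩
  have hτ0 : 0 < τ := hτa.trans_le ((le_max_left _ _).trans hτ)
  obtain ⟨Na, hNa⟩ := hUa τ ((le_max_left _ _).trans hτ)
  obtain ⟨Nb, hNb⟩ := hFb τ ((le_max_right _ _).trans hτ)
  refine ⟨max Na Nb, fun N hN s hs => ?_⟩
  have h1 := hNa N ((le_max_left _ _).trans hN) s hs
  have h2 := hNb N ((le_max_right _ _).trans hN) s hs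
  set P := localGibbsLaw σ a₀ u₀ θ₀ N (Φ N) with hP
  set A : Cfg N → ℝ := fun z => ((N : ℝ) + 1)⁻¹ * ∑ i : Fin (N + 1), tailFn L' (act (Φ N) τ s i z) with hA
  set B : Cfg N → ℝ := fun z => ((N : ℝ) + 1)⁻¹ * ∑ i : Fin (N + 1), fracFn V (act (Φ N) τ s i z) with hB
  have hN0 : (0 : ℝ) ≤ ((N : ℝ) + 1)⁻¹ := by positivity
  have hpt : ∀ z, ((N : ℝ) + 1)⁻¹ * ∑ i : Fin (N + 1), tailFn V (act (Φ N) τ s i z) ≤ A z + L' * B z := by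
    intro z
    have hsum : ∑ i : Fin (N + 1), tailFn V (act (Φ N) τ s i z) ≤
        ∑ i : Fin (N + 1), (tailFn L' (act (Φ N) τ s i z) + L' * fracFn V (act (Φ N) τ s i z)) :=
      Finset.sum_le_sum fun i _ =>
        tailFn_le_tailFn_add_mul_fracFn hL'0.le (act_nonneg hσ.le (Φ N) hτ0.le s i z)
    calc ((N : ℝ) + 1)⁻¹ * ∑ i : Fin (N + 1), tailFn V (act (Φ N) τ s i z)
        ≤ ((N : ℝ) + 1)⁻¹ * ∑ i : Fin (N + 1),
            (tailFn L' (act (Φ N) τ s i z) + L' * fracFn V (act (Φ N) τ s i z)) :=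
          mul_le_mul_of_nonneg_left hsum hN0
      _ = A z + L' * B z := by
          simp only [hA, hB, Finset.sum_add_distrib, ← Finset.mul_sum]
          ring
  have hA0 : ∀ z, 0 ≤ A z := fun z =>
    mul_nonneg hN0 (Finset.sum_nonneg fun i _ => tailFn_nonneg (act_nonneg hσ.le (Φ N) hτ0.le s i z))
  have hB0 : ∀ z, 0 ≤ B z := fun z => mul_nonneg hN0 (Finset.sum_nonneg fun i _ => fracFn_nonneg V _)
  have hmA : AEMeasurable A P :=
    (aemeasurable_sum_tailFn_act hσ hσh a₀ θ₀ u₀ N (Φ N) τ s L').const_mul _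
  have hAle : ∫⁻ z, ENNReal.ofReal (A z) ∂P ≤ ENNReal.ofReal (ε / 2) := by
    refine le_trans (lintegral_mono fun z => ENNReal.ofReal_le_ofReal ?_) h1
    exact mul_le_mul_of_nonneg_left (Finset.sum_le_sum fun i _ =>
      tailFn_anti (le_max_left L 1) (act_nonneg hσ.le (Φ N) hτ0.le s i z)) hN0
  have hBle : ∫⁻ z, ENNReal.ofReal (B z) ∂P ≤ ENNReal.ofReal (ε / 2 / L') := h2
  calc ∫⁻ z, ENNReal.ofReal (((N : ℝ) + 1)⁻¹ * ∑ i : Fin (N + 1), tailFn V (act (Φ N) τ s i z)) ∂P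
      ≤ ∫⁻ z, ENNReal.ofReal (A z + L' * B z) ∂P := lintegral_mono fun z => ENNReal.ofReal_le_ofReal (hpt z)
    _ = ∫⁻ z, ENNReal.ofReal (A z) + ENNReal.ofReal L' * ENNReal.ofReal (B z) ∂P := by
        refine lintegral_congr fun z => ?_
        rw [ENNReal.ofReal_add (hA0 z) (mul_nonneg hL'0.le (hB0 z)), ENNReal.ofReal_mul hL'0.le]
    _ = ∫⁻ z, ENNReal.ofReal (A z) ∂P + ENNReal.ofReal L' * ∫⁻ z, ENNReal.ofReal (B z) ∂P := by
        rw [lintegral_add_left' hmA.ennreal_ofReal, lintegral_const_mul' _ _ ENNReal.ofReal_ne_top]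
    _ ≤ ENNReal.ofReal (ε / 2) + ENNReal.ofReal L' * ENNReal.ofReal (ε / 2 / L') :=
        add_le_add hAle (mul_le_mul_right hBle _)
    _ = ENNReal.ofReal ε := by
        rw [← ENNReal.ofReal_mul hL'0.le, mul_div_cancel₀ _ hL'0.ne',
          ← ENNReal.ofReal_add (half_pos hε).le (half_pos hε).le, add_halves]

/-! ## §5 The registered stubs -/

/-- **STUB A** (hardest; the line's own open dynamical input): the one-flight aiming supermartingale inequality. -/
theorem stub_aimingSupermartingale : OneFlightAimingSupermartingale := by
  sorry

/-- **STUB B**: own-birth thinning + Bennett on dyadic blocks + static / Serre pricing of abnormal births ⇒ the equilibrium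
regular-hub large deviation (the COUNT rung in exponential-moment form). -/
theorem stub_equilibriumHubLD : OneFlightAimingSupermartingale → EquilibriumHubLD := by
  sorry

/-- **STUB C**: entropy inequality against the flow-invariant constant Gibbs law (`γ → ∞` after `τ → ∞`, legitimate because
the per-hub cost grows with `τ`) ⇒ the regular-hub fraction vanishes under the true pre-shock law. -/
theorem stub_hubFraction : EquilibriumHubLD → HubFractionVanishes := by
  sorry

/-- **STUB D** (import, conjecture-grade; discharged by stmt-13677 via `preShockLanfordEnvelope_of_lanfordEnvelopeR`). -/
theorem stub_preShockLanfordEnvelope : PreShockLanfordEnvelope := by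
  sorry

/-- **STUB E**: the envelope prices the persistent-structure branch (all-order counting on a time grid) and the UI half
(sub-window convexity + Serre + short-time trees from an enveloped law). -/
theorem stub_outliersOfEnvelope : PreShockLanfordEnvelope → DenseVisitFractionVanishes ∧ ActivityUI := by
  sorry

/-- **STUB F** (the seam): pathwise `{V < a_i} ⊆ regularHub(x, u, K, y) ∪ denseVisit(K, y)` with `V = 2σux`
(`impulse ≤ relative speed`, `r ≤ u + r²/u`), `K = ⌈τ⌉ ∈ [τ, τ²]`, `y = y₀` of the dense branch, `x₀ = x₀(u, y₀)` of the
hub branch; plus a.e.-measurability of the two indicator sums to split the integral. -/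
theorem stub_fractionCovering : HubFractionVanishes → DenseVisitFractionVanishes → ActivityFraction := by
  sorry

/-! ## §6 The composition -/

/-- **COMPOSITION over the six statements** (sorry-free logic; concludes the local abbrev `Crux`). -/
theorem crux_of_stubs (hA : OneFlightAimingSupermartingale) (hB : OneFlightAimingSupermartingale → EquilibriumHubLD)
    (hC : EquilibriumHubLD → HubFractionVanishes) (hD : PreShockLanfordEnvelope)
    (hE : PreShockLanfordEnvelope → DenseVisitFractionVanishes ∧ ActivityUI)
    (hF : HubFractionVanishes → DenseVisitFractionVanishes → ActivityFraction) : Crux :=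
  crux_of_activityUI_of_activityFraction (hE hD).2 (hF (hC (hB hA)) (hE hD).1)

/-- **`CollisionActivityTails_of`** — the line's composition closes the crux BY NAME (route OneFlightGossipEngine's decl) from
the six registered stubs. -/
theorem CollisionActivityTails_of :
    Summit.AtomisticToContinuum.HydrodynamicLimit.Theses.OneFlightGossipEngine.CollisionActivityTails :=
  crux_of_stubs stub_aimingSupermartingale stub_equilibriumHubLD stub_hubFraction stub_preShockLanfordEnvelope
    stub_outliersOfEnvelope stub_fractionCovering

end Summit.AtomisticToContinuum.HydrodynamicLimit.Cruxes.CollisionActivityTails.PlaqueThinningCountLd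

end
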